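import Summits.Ventures.PercRepro.C041ZoneOCubeCountCS

/-!
# THEOREM (ONE MARKED VERTEX), part 1 — the status of a marked vertex, the complementation involution and the
dictionary (mine-3, gen 58; C-041.md §19 (j))

Setting of `C041ZoneOCubeCountDefs` / `C041ZoneOCubeCountCS` (p6's `ZoneZ` model): a zone `Z : ZoneData V E T₁ T₂`
with a single anchor `k`, ANY multigraph (cycles allowed), whose terminal edges all sit at ONE vertex `v`
(`∀ i, Z.at₁ i = v`, `∀ j, Z.at₂ j = v`; `v = k` is allowed).  This module: blue / red adjacency of an edge
colouring alone (`BlueAdjE` / `RedAdjE`, the `BlueAdj` / `RedAdj` of every state with that colouring), the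
EDGE-COMPLEMENTATION `cpl ω = !ω` which exchanges them (`blueAdjE_cpl` / `redAdjE_cpl`), the STATUS of `v` under a
colouring — merged `Mg` (in the blue reach of the anchor) / reached `Rd` (in the red reach) — exchanged by the
complementation (`Mg_cpl` / `Rd_cpl`), the DICTIONARY for the count sets when every terminal edge sits at `v`
(`mem_D_iff_ov`, `mem_D2_iff_ov`, `adm_iff_ov`, `blueK_iff_ov`), the fibre-wise count of a finite set of pairs
(`card_eq_sum_fibres`) and the four mark counts at one vertex (`nAdmOV`, `nT1OV`, `nT2OV`, `nJOV`) with
`nJOV ≤ 1` and `nJOV = 0 → 1 ≤ nT1OV, nT2OV`.  The theorem itself is `C041ZoneOneVertex`.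
-/

namespace PercRepro

namespace ZoneZ

namespace ZoneData

open Finset

variable {V E T₁ T₂ : Type*} (Z : ZoneData V E T₁ T₂)

/-! ## Adjacency through an edge colouring alone -/

/-- Blue adjacency of an edge colouring `ω` (the `BlueAdj` of any state with first component `ω`). -/
def BlueAdjE (ω : E → Bool) (u w : V) : Prop := ∃ e, Z.Joins e u w ∧ ω e = false

/-- Red adjacency of an edge colouring `ω`. -/
def RedAdjE (ω : E → Bool) (u w : V) : Prop := ∃ e, Z.Joins e u w ∧ ω e = true

/-- `BlueAdj` depends on the edge colouring only. -/
theorem blueAdj_eq_blueAdjE (σ : State E T₁ T₂) : Z.BlueAdj σ = Z.BlueAdjE σ.1 := rfl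

/-- `RedAdj` depends on the edge colouring only. -/
theorem redAdj_eq_redAdjE (σ : State E T₁ T₂) : Z.RedAdj σ = Z.RedAdjE σ.1 := rfl

/-- The edge complementation: every edge changes colour. -/
def cpl (ω : E → Bool) : E → Bool := fun e => !ω e

/-- The complementation is an involution. -/
theorem cpl_cpl (ω : E → Bool) : cpl (cpl ω) = ω := by
  funext e
  simp [cpl]

/-- Blue adjacency of the complement is red adjacency. -/
theorem blueAdjE_cpl (ω : E → Bool) : Z.BlueAdjE (cpl ω) = Z.RedAdjE ω := by
  funext u w
  simp only [BlueAdjE, RedAdjE, cpl, Bool.not_eq_false']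

/-- Red adjacency of the complement is blue adjacency. -/
theorem redAdjE_cpl (ω : E → Bool) : Z.RedAdjE (cpl ω) = Z.BlueAdjE ω := by
  funext u w
  simp only [BlueAdjE, RedAdjE, cpl, Bool.not_eq_true']

variable (k v : V)

/-- `Mg ω`: the marked vertex `v` is MERGED — it lies in the blue reach of the anchor `k`. -/
def Mg (ω : E → Bool) : Prop := v ∈ reach (Z.BlueAdjE ω) {k}

/-- `Rd ω`: the marked vertex `v` is REACHED — it lies in the red reach of the anchor `k`. -/
def Rd (ω : E → Bool) : Prop := v ∈ reach (Z.RedAdjE ω) {k}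

/-- Under complementation, merged becomes reached. -/
theorem Mg_cpl (ω : E → Bool) : Z.Mg k v (cpl ω) ↔ Z.Rd k v ω := by
  unfold Mg Rd
  rw [blueAdjE_cpl]

/-- Under complementation, reached becomes merged. -/
theorem Rd_cpl (ω : E → Bool) : Z.Rd k v (cpl ω) ↔ Z.Mg k v ω := by
  unfold Mg Rd
  rw [redAdjE_cpl]

/-! ## The dictionary when every terminal edge sits at `v` -/

section OneVertex

variable (h1 : ∀ i, Z.at₁ i = v) (h2 : ∀ j, Z.at₂ j = v)
include h1 h2

/-- The blockers: `v` iff `v` carries a blue `1`-edge. -/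
theorem mem_Bl_iff_ov (ω : E → Bool) (μ : (T₁ → Bool) × (T₂ → Bool)) (x : V) :
    x ∈ Z.Bl (ω, μ) ↔ x = v ∧ ∃ i, μ.1 i = false := by
  simp only [Bl, markSet, Set.mem_setOf_eq, h1]
  constructor
  · rintro ⟨i, rfl, hi⟩
    exact ⟨rfl, i, hi⟩
  · rintro ⟨rfl, i, hi⟩
    exact ⟨i, rfl, hi⟩

/-- The red `1`-edges: at `v` iff `v` carries one. -/
theorem mem_Blt_iff_ov (ω : E → Bool) (μ : (T₁ → Bool) × (T₂ → Bool)) (x : V) :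
    x ∈ Z.Blt (ω, μ) ↔ x = v ∧ ∃ i, μ.1 i = true := by
  simp only [Blt, markSet, Set.mem_setOf_eq, h1]
  constructor
  · rintro ⟨i, rfl, hi⟩
    exact ⟨rfl, i, hi⟩
  · rintro ⟨rfl, i, hi⟩
    exact ⟨i, rfl, hi⟩

/-- The blue `2`-edges: at `v` iff `v` carries one. -/
theorem mem_M_iff_ov (ω : E → Bool) (μ : (T₁ → Bool) × (T₂ → Bool)) (x : V) :
    x ∈ Z.M (ω, μ) ↔ x = v ∧ ∃ j, μ.2 j = false := by
  simp only [M, markSet, Set.mem_setOf_eq, h2]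
  constructor
  · rintro ⟨j, rfl, hj⟩
    exact ⟨rfl, j, hj⟩
  · rintro ⟨rfl, j, hj⟩
    exact ⟨j, rfl, hj⟩

/-- The red `2`-edges: at `v` iff `v` carries one. -/
theorem mem_Mt_iff_ov (ω : E → Bool) (μ : (T₁ → Bool) × (T₂ → Bool)) (x : V) :
    x ∈ Z.Mt (ω, μ) ↔ x = v ∧ ∃ j, μ.2 j = true := by
  simp only [Mt, markSet, Set.mem_setOf_eq, h2]
  constructor
  · rintro ⟨j, rfl, hj⟩
    exact ⟨rfl, j, hj⟩
  · rintro ⟨rfl, j, hj⟩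
    exact ⟨j, rfl, hj⟩

/-- The anchor is deleted iff `v` is merged and carries a blue `1`-edge. -/
theorem mem_D_iff_ov (ω : E → Bool) (μ : (T₁ → Bool) × (T₂ → Bool)) :
    k ∈ Z.D (ω, μ) ↔ Z.Mg k v ω ∧ ∃ i, μ.1 i = false := by
  rw [Z.mem_D_iff_inter]
  constructor
  · rintro ⟨x, hxP, hxB⟩
    rw [Z.mem_Bl_iff_ov v h1 h2] at hxB
    obtain ⟨rfl, hb⟩ := hxB
    exact ⟨hxP, hb⟩
  · rintro ⟨hm, hb⟩
    exact ⟨v, hm, (Z.mem_Bl_iff_ov v h1 h2 ω μ v).2 ⟨rfl, hb⟩⟩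

/-- The anchor is deleted on side `2` iff `v` is merged and carries a blue `2`-edge. -/
theorem mem_D2_iff_ov (ω : E → Bool) (μ : (T₁ → Bool) × (T₂ → Bool)) :
    k ∈ Z.D2 (ω, μ) ↔ Z.Mg k v ω ∧ ∃ j, μ.2 j = false := by
  rw [Z.mem_D2_iff_inter]
  constructor
  · rintro ⟨x, hxP, hxM⟩
    rw [Z.mem_M_iff_ov v h1 h2] at hxM
    obtain ⟨rfl, hb⟩ := hxM
    exact ⟨hxP, hb⟩
  · rintro ⟨hm, hb⟩
    exact ⟨v, hm, (Z.mem_M_iff_ov v h1 h2 ω μ v).2 ⟨rfl, hb⟩⟩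

/-- Admissible iff `v` does not carry blue edges of both types. -/
theorem adm_iff_ov (ω : E → Bool) (μ : (T₁ → Bool) × (T₂ → Bool)) :
    Z.adm (ω, μ) ↔ ¬ ((∃ i, μ.1 i = false) ∧ ∃ j, μ.2 j = false) := by
  unfold adm
  rw [Set.disjoint_left]
  constructor
  · intro h hb
    apply h ((Z.mem_M_iff_ov v h1 h2 ω μ v).2 ⟨rfl, hb.2⟩)
    exact subset_reach ((Z.mem_Bl_iff_ov v h1 h2 ω μ v).2 ⟨rfl, hb.1⟩)
  · intro h x hxM hxD
    rw [Z.mem_M_iff_ov v h1 h2] at hxM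
    obtain ⟨s, hs, -⟩ := hxD
    rw [Z.mem_Bl_iff_ov v h1 h2] at hs
    exact h ⟨hs.2, hxM.2⟩

/-- Blue at `K` iff `v` is not reached or carries no red terminal edge. -/
theorem blueK_iff_ov (ω : E → Bool) (μ : (T₁ → Bool) × (T₂ → Bool)) :
    Z.blueK {k} (ω, μ) ↔ ¬ (Z.Rd k v ω ∧ ((∃ i, μ.1 i = true) ∨ ∃ j, μ.2 j = true)) := by
  unfold blueK
  rw [Set.disjoint_left]
  constructor
  · intro h hr
    rcases hr.2 with hr1 | hr2
    · exact h hr.1 (Or.inl ((Z.mem_Blt_iff_ov v h1 h2 ω μ v).2 ⟨rfl, hr1⟩))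
    · exact h hr.1 (Or.inr ((Z.mem_Mt_iff_ov v h1 h2 ω μ v).2 ⟨rfl, hr2⟩))
  · intro h x hxK hx
    rcases hx with hx | hx
    · rw [Z.mem_Blt_iff_ov v h1 h2] at hx
      obtain ⟨rfl, hx⟩ := hx
      exact h ⟨hxK, Or.inl hx⟩
    · rw [Z.mem_Mt_iff_ov v h1 h2] at hx
      obtain ⟨rfl, hx⟩ := hx
      exact h ⟨hxK, Or.inr hx⟩

end OneVertex

/-! ## Counting: fibres over the edge colouring -/

/-- A finite set of pairs is counted fibre by fibre over the first coordinate. -/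
theorem card_eq_sum_fibres {α β : Type*} [Fintype α] [Fintype β] [DecidableEq α] [DecidableEq β]
    (s : Finset (α × β)) : #s = ∑ a, #(univ.filter fun b => (a, b) ∈ s) := by
  rw [Finset.card_eq_sum_card_fiberwise (f := Prod.fst) (t := univ) (fun _ _ => mem_univ _)]
  refine Finset.sum_congr rfl fun a _ => ?_
  refine Finset.card_nbij' Prod.snd (fun b => (a, b)) ?_ ?_ ?_ ?_
  · intro x hx
    simp only [coe_filter, Set.mem_setOf_eq] at hx
    simp only [coe_filter, mem_univ, true_and, Set.mem_setOf_eq]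
    rw [← hx.2]
    exact hx.1
  · intro b hb
    simp only [coe_filter, mem_univ, true_and, Set.mem_setOf_eq] at hb
    simp only [coe_filter, Set.mem_setOf_eq]
    exact ⟨hb, trivial⟩
  · intro x hx
    simp only [coe_filter, Set.mem_setOf_eq] at hx
    rw [← hx.2]
  · intro b _
    rfl

section Counts

variable [Fintype E] [DecidableEq E] [Fintype T₁] [DecidableEq T₁] [Fintype T₂] [DecidableEq T₂]

/-- The admissible mark patterns at one vertex: not blue on both sides. -/
noncomputable def nAdmOV (T₁ T₂ : Type*) [Fintype T₁] [DecidableEq T₁] [Fintype T₂] [DecidableEq T₂] : ℕ :=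
  #(univ.filter fun μ : (T₁ → Bool) × (T₂ → Bool) => ¬ ((∃ i, μ.1 i = false) ∧ ∃ j, μ.2 j = false))

/-- The type-1 patterns at one vertex: a blue `1`-edge, no blue `2`-edge. -/
noncomputable def nT1OV (T₁ T₂ : Type*) [Fintype T₁] [DecidableEq T₁] [Fintype T₂] [DecidableEq T₂] : ℕ :=
  #(univ.filter fun μ : (T₁ → Bool) × (T₂ → Bool) => (∃ i, μ.1 i = false) ∧ ¬ ∃ j, μ.2 j = false)

/-- The type-2 patterns at one vertex: a blue `2`-edge, no blue `1`-edge. -/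
noncomputable def nT2OV (T₁ T₂ : Type*) [Fintype T₁] [DecidableEq T₁] [Fintype T₂] [DecidableEq T₂] : ℕ :=
  #(univ.filter fun μ : (T₁ → Bool) × (T₂ → Bool) => (¬ ∃ i, μ.1 i = false) ∧ ∃ j, μ.2 j = false)

/-- The admissible all-blue patterns at one vertex (`1` if one side has no terminal edge, else `0`). -/
noncomputable def nJOV (T₁ T₂ : Type*) [Fintype T₁] [DecidableEq T₁] [Fintype T₂] [DecidableEq T₂] : ℕ :=
  #(univ.filter fun μ : (T₁ → Bool) × (T₂ → Bool) =>
    ¬ ((∃ i, μ.1 i = false) ∧ ∃ j, μ.2 j = false) ∧ ¬ ((∃ i, μ.1 i = true) ∨ ∃ j, μ.2 j = true))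

/-- At most one admissible all-blue pattern. -/
theorem nJOV_le_one : nJOV T₁ T₂ ≤ 1 := by
  unfold nJOV
  rw [Finset.card_le_one]
  intro μ hμ μ' hμ'
  simp only [mem_filter, mem_univ, true_and, not_or, not_exists, Bool.not_eq_true] at hμ hμ'
  ext i
  · rw [hμ.2.1 i, hμ'.2.1 i]
  · rw [hμ.2.2 i, hμ'.2.2 i]

/-- If the all-blue pattern is inadmissible, both sides carry a terminal edge. -/
theorem nonempty_of_nJOV (h : nJOV T₁ T₂ = 0) : Nonempty T₁ ∧ Nonempty T₂ := by
  unfold nJOV at h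
  rw [Finset.card_eq_zero, Finset.filter_eq_empty_iff] at h
  have hb : ¬ (¬ ((∃ i : T₁, (false : Bool) = false) ∧ ∃ j : T₂, (false : Bool) = false) ∧
      ¬ ((∃ i : T₁, (false : Bool) = true) ∨ ∃ j : T₂, (false : Bool) = true)) :=
    h (mem_univ ((fun _ => false, fun _ => false) : (T₁ → Bool) × (T₂ → Bool)))
  have hr : ¬ ((∃ i : T₁, (false : Bool) = true) ∨ ∃ j : T₂, (false : Bool) = true) := by
    rintro (⟨_, hi⟩ | ⟨_, hj⟩)
    · exact Bool.false_ne_true hi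
    · exact Bool.false_ne_true hj
  have hb' : (∃ i : T₁, (false : Bool) = false) ∧ ∃ j : T₂, (false : Bool) = false := by
    by_contra hc
    exact hb ⟨hc, hr⟩
  obtain ⟨⟨i, -⟩, ⟨j, -⟩⟩ := hb'
  exact ⟨⟨i⟩, ⟨j⟩⟩

/-- If the all-blue pattern is inadmissible, type-1 patterns exist. -/
theorem one_le_nT1OV_of_nJOV (h : nJOV T₁ T₂ = 0) : 1 ≤ nT1OV T₁ T₂ := by
  obtain ⟨⟨i⟩, -⟩ := nonempty_of_nJOV h
  unfold nT1OV
  apply Finset.card_pos.2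
  refine ⟨(fun _ => false, fun _ => true), ?_⟩
  simp only [mem_filter, mem_univ, true_and]
  refine ⟨⟨i, by simp⟩, ?_⟩
  rintro ⟨_, hj⟩
  simp at hj

/-- If the all-blue pattern is inadmissible, type-2 patterns exist. -/
theorem one_le_nT2OV_of_nJOV (h : nJOV T₁ T₂ = 0) : 1 ≤ nT2OV T₁ T₂ := by
  obtain ⟨-, ⟨j⟩⟩ := nonempty_of_nJOV h
  unfold nT2OV
  apply Finset.card_pos.2
  refine ⟨(fun _ => true, fun _ => false), ?_⟩
  simp only [mem_filter, mem_univ, true_and]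
  refine ⟨?_, ⟨j, by simp⟩⟩
  rintro ⟨_, hi⟩
  simp at hi

end Counts


end ZoneData

end ZoneZ

end PercRepro
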